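import Literature.AnabelianGeometry.SemiGraphs.TemperedAbsoluteness
import Literature.AnabelianGeometry.SemiGraphs.TemperedAnabelianThm66SubProofs

/-!
# [SemiAnbd] Cor. 6.10 / Cor. 6.11: the printed reductions over the typed interface

Mochizuki, *Semi-graphs of anabelioids*, Publ. RIMS **42** (2006) [SemiAnbd], §6 pp. 77–78.  PROOF-ONLY
companion (abc-iut seat f-168, F fact-proving wave, tranche 168; rung LADDER-ABC:A2.C) of abc-iut-L3-t4's
`TemperedAbsoluteness.lean` (FROZEN; imported, never edited) for the FROZEN FACT-LIST rows **F-1656**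
`AbsolutenessOrigin.TemperedAbsolutenessHolds` (Cor. 6.10) and **F-1655** `…GenusZeroTempAbsolutenessHolds`
(Cor. 6.11).  Their universal closures over the origin certificate `Ω` are REFUTED in the tree
(abc-iut-w6-d028, `TemperedAbsolutenessSchemaNegative.lean`), so both rows are consumable at the genuine
certificate only.  This file records the POSITIVE side — the printed proofs as reductions over the typed
interface, with the interface laws they use spelled out as HYPOTHESES (inlined; no new `Prop` definition,
no new named fact):
* Cor. 6.11 ⟸ Cor. 6.10 + [Mzk8] Cor. 4.11 (p. 78 l. 1–2: "this follows by formally 'substituting' the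
  equivalences of Corollary 6.10, (i), (ii), into [Mzk8], Corollary 4.11"):
  `genusZeroTempAbsolutenessHolds_of_temperedAbsolutenessHolds` — F-1655 ⟸ F-1656 + the ABSOLUTE
  [Mzk8] Cor. 4.11 input as a hypothesis binder (not typed in the tree);
* Cor. 6.10 (ii), BOTH directions (`unitwiseAbsoluteIffTempAbsolute_of_profiniteOuterIsoLifts`) ⟸ Thm. 6.6
  as typed (`TemperedCurve.ProfiniteOuterIsoLifts`, BY NAME via `TemperedOrigin.ProfiniteOuterIsoLiftsHolds`
  = FACT-LIST F-1707) + the completion of tempered isomorphisms (`TemperedCurve.temperedIsoCompletes_holds`,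
  PROVED in the tree) + the GOODNESS / TRANSPORT LAW of the Kummer transport datum (p. 77: "`Π^temp_{X_K}`
  is also good. We thus conclude [cf. Theorem 6.6]"): the maps on `H¹(−, μ_Ẑ(−))` induced by `α̂` and by a
  `β` lying under it carry the Kummer image of the units to the same subgroup — an interface law
  (`KummerTransport` "carries no functoriality law", `TemperedAbsolutenessNonVacuity.lean`);
* Cor. 6.10 (i), direction "absolute ⇒ temp-absolute" (`isDiscretelyTempAbsoluteCusp_of_…`,
  `isIntegrallyTempAbsoluteCusp_of_…`) ⟸ the completion `β̂` of `β` (tree) + the TRANSPORT of `D̂_x` and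
  of the closures of the structure subgroups along `β̂` (PROVED here) + ONE interface law of
  `CuspidalStructures`: members of the canonical discrete structure are COMPACT ([Mzk8] §4 p. 33: a
  splitting is the image of a continuous section of `D_x ↠ G_K`), under which `S ↦ closure ι(S)` is
  injective (`ι : Π^temp ↪ Π̂` injective, `Π̂` Hausdorff).  The converse direction (Thm. 6.6 + Thm. 6.5
  (iii) + profinite cuspidal rigidity) is the companion file `TemperedAbsolutenessReductionsConverse.lean`.
HONEST FRAMING: statements about OUR typed interface of a refereed prerequisite paper; the hypotheses
named "law" are properties the genuine data have in print which the typed records do not carry; nothing is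
asserted; typed ≠ proved; no bearing on, and no side taken on, [IUTchIII] Cor. 3.12.
[cite: MochizukiSemiAnbd2006, Cor 6.10 p.77] [cite: MochizukiSemiAnbd2006, Cor 6.11 pp.77-78]
-/

noncomputable section

namespace Literature.AnabelianGeometry.SemiGraphs

open scoped Pointwise
open _root_.Topology

universe u v

variable {p : ℕ} [Fact p.Prime]

/-! ### 1. Transport of closures of images along a tempered isomorphism lying under a profinite one -/

section Algebra

variable {G : Type u} {H : Type v} [Group G] [Group H]

/-- Conjugation of a subgroup by `c`, as a set: `↑(c • K) = {c k c⁻¹}`. [folklore] -/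
private theorem coe_conjAct_smul_eq_image (c : G) (K : Subgroup G) :
    ((ConjAct.toConjAct c • K : Subgroup G) : Set G) = (fun y => c * y * c⁻¹) '' (K : Set G) := by
  ext y
  rw [Subgroup.coe_pointwise_smul, Set.mem_smul_set, Set.mem_image]
  constructor
  · rintro ⟨k, hk, rfl⟩
    exact ⟨k, hk, by rw [ConjAct.smul_def, ConjAct.ofConjAct_toConjAct]⟩
  · rintro ⟨k, hk, rfl⟩
    exact ⟨k, hk, by rw [ConjAct.smul_def, ConjAct.ofConjAct_toConjAct]⟩

/-- The image of a conjugate subgroup under a homomorphism is the conjugate of the image. [folklore] -/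
private theorem map_conjAct_smul_ofConjAct (f : G →* H) (γ : ConjAct G) (K : Subgroup G) :
    (γ • K).map f = ConjAct.toConjAct (f (ConjAct.ofConjAct γ)) • K.map f := by
  apply SetLike.coe_injective
  have hγ : γ = ConjAct.toConjAct (ConjAct.ofConjAct γ) := (ConjAct.toConjAct_ofConjAct γ).symm
  conv_lhs => rw [hγ]
  rw [Subgroup.coe_map, coe_conjAct_smul_eq_image, coe_conjAct_smul_eq_image, Subgroup.coe_map,
    Set.image_image, Set.image_image]
  refine Set.image_congr' fun k => ?_
  simp only [map_mul, map_inv]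

end Algebra

section Topology

variable {G : Type u} {H : Type v} [Group G] [TopologicalSpace G] [IsTopologicalGroup G]
  [Group H] [TopologicalSpace H] [IsTopologicalGroup H]

/-- Conjugation commutes with topological closure of subgroups. [folklore] -/
private theorem conjAct_smul_topologicalClosure (c : G) (K : Subgroup G) :
    ConjAct.toConjAct c • K.topologicalClosure = (ConjAct.toConjAct c • K).topologicalClosure := by
  apply SetLike.coe_injective
  rw [coe_conjAct_smul_eq_image, Subgroup.topologicalClosure_coe, Subgroup.topologicalClosure_coe,
    coe_conjAct_smul_eq_image]
  exact ((Homeomorph.mulLeft c).trans (Homeomorph.mulRight c⁻¹)).image_closure (K : Set G)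

/-- Topological closure of subgroups commutes with isomorphisms of topological groups. [folklore] -/
private theorem map_topologicalClosure_continuousMulEquiv (e : G ≃ₜ* H) (K : Subgroup G) :
    K.topologicalClosure.map e.toMulEquiv.toMonoidHom =
      (K.map e.toMulEquiv.toMonoidHom).topologicalClosure := by
  apply SetLike.coe_injective
  rw [Subgroup.coe_map, Subgroup.topologicalClosure_coe, Subgroup.topologicalClosure_coe,
    Subgroup.coe_map]
  exact e.toHomeomorph.image_closure (K : Set G)

end Topology

namespace TemperedCurve

variable {X Y : TemperedCurve p}

/-- **Transport of closures along a lifting pair** ([SemiAnbd] Thm. 6.6 p. 72 / Cor. 6.10 p. 77): if the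
tempered isomorphism `β` lies under the profinite isomorphism `α̂` through `c ∈ Π_{Y_L}`
(`α̂ ∘ ι_X = Inn(c) ∘ ι_Y ∘ β`), then for every subgroup `S ⊆ Π^temp_{X_K}`,
`α̂( closure ι_X(S) ) = c · closure ι_Y(β(S)) · c⁻¹`. [cite: MochizukiSemiAnbd2006, Cor 6.10 p.77] -/
theorem map_closure_map_toHat_eq_of_liesUnder (αhat : X.PiHat ≃ₜ* Y.PiHat) (β : X.PiTemp ≃ₜ* Y.PiTemp)
    (c : Y.PiHat) (h : ∀ g : X.PiTemp, αhat (X.toHat g) = c * Y.toHat (β g) * c⁻¹)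
    (S : Subgroup X.PiTemp) :
    ((S.map X.toHat.toMonoidHom).topologicalClosure).map αhat.toMulEquiv.toMonoidHom =
      ConjAct.toConjAct c •
        ((S.map β.toMulEquiv.toMonoidHom).map Y.toHat.toMonoidHom).topologicalClosure := by
  rw [map_topologicalClosure_continuousMulEquiv αhat, conjAct_smul_topologicalClosure]
  congr 1
  apply SetLike.coe_injective
  rw [Subgroup.coe_map, Subgroup.coe_map, coe_conjAct_smul_eq_image, Subgroup.coe_map, Subgroup.coe_map,
    Set.image_image, Set.image_image, Set.image_image]
  exact Set.image_congr' fun g => h g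

/-- The case `c = 1` (`β̂` is THE completion of `β`, `α̂ ∘ ι_X = ι_Y ∘ β`):
`β̂( closure ι_X(S) ) = closure ι_Y(β(S))`. [cite: MochizukiSemiAnbd2006, Cor 6.10 p.77] -/
theorem map_closure_map_toHat_eq_of_completes (αhat : X.PiHat ≃ₜ* Y.PiHat) (β : X.PiTemp ≃ₜ* Y.PiTemp)
    (h : ∀ g : X.PiTemp, αhat (X.toHat g) = Y.toHat (β g)) (S : Subgroup X.PiTemp) :
    ((S.map X.toHat.toMonoidHom).topologicalClosure).map αhat.toMulEquiv.toMonoidHom =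
      ((S.map β.toMulEquiv.toMonoidHom).map Y.toHat.toMonoidHom).topologicalClosure := by
  have h1 := map_closure_map_toHat_eq_of_liesUnder αhat β 1 (fun g => by simpa using h g) S
  simpa using h1

/-- `D̂_x` is carried by the completion `β̂` of `β` to the `ι_Y(γ)`-conjugate of `D̂_y` whenever
`β(D_x) = γ D_y γ⁻¹` (p. 77: "`D̂_x` also forms a 'profinite `D_x ⊆ Π_{X_K}`'").
[cite: MochizukiSemiAnbd2006, §6 p.77] -/
theorem map_decompHat_eq_of_completes (αhat : X.PiHat ≃ₜ* Y.PiHat) (β : X.PiTemp ≃ₜ* Y.PiTemp)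
    (h : ∀ g : X.PiTemp, αhat (X.toHat g) = Y.toHat (β g)) (x : X.Pt) (y : Y.Pt) (γ : ConjAct Y.PiTemp)
    (hD : (X.decomp x).map β.toMulEquiv.toMonoidHom = γ • Y.decomp y) :
    (X.decompHat x).map αhat.toMulEquiv.toMonoidHom =
      ConjAct.toConjAct (Y.toHat (ConjAct.ofConjAct γ)) • Y.decompHat y := by
  rw [decompHat, decompHat, map_closure_map_toHat_eq_of_completes αhat β h, hD,
    map_conjAct_smul_ofConjAct, conjAct_smul_topologicalClosure]
  rfl

/-- The closure map `S ↦ closure ι_Y(S)` intertwines `β` / `β̂` on sets of subgroups: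
`β̂( hatOf_X 𝒮 ) = hatOf_Y( β 𝒮 )`. [cite: MochizukiSemiAnbd2006, §6 p.77] -/
theorem image_map_hatOf_eq_of_completes (αhat : X.PiHat ≃ₜ* Y.PiHat) (β : X.PiTemp ≃ₜ* Y.PiTemp)
    (h : ∀ g : X.PiTemp, αhat (X.toHat g) = Y.toHat (β g)) (𝒮 : Set (Subgroup X.PiTemp)) :
    (fun S => S.map αhat.toMulEquiv.toMonoidHom) '' X.hatOf 𝒮 =
      Y.hatOf ((fun S => S.map β.toMulEquiv.toMonoidHom) '' 𝒮) := by
  rw [hatOf, hatOf, Set.image_image, Set.image_image]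
  exact Set.image_congr' fun S => map_closure_map_toHat_eq_of_completes αhat β h S

/-- Conjugation intertwines with the closure map: `ι_Y(γ) · hatOf_Y 𝒮 · ι_Y(γ)⁻¹ = hatOf_Y (γ 𝒮 γ⁻¹)`.
[cite: MochizukiSemiAnbd2006, §6 p.77] -/
theorem image_conj_hatOf_eq (γ : ConjAct Y.PiTemp) (𝒮 : Set (Subgroup Y.PiTemp)) :
    (fun S => ConjAct.toConjAct (Y.toHat (ConjAct.ofConjAct γ)) • S) '' Y.hatOf 𝒮 =
      Y.hatOf ((fun S => γ • S) '' 𝒮) := by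
  rw [hatOf, hatOf, Set.image_image, Set.image_image]
  refine Set.image_congr' fun S => ?_
  rw [map_conjAct_smul_ofConjAct, conjAct_smul_topologicalClosure]
  rfl

/-- Transport of `hatOf` along a lifting pair: `α̂( hatOf_X 𝒮 ) = c · hatOf_Y( β 𝒮 ) · c⁻¹`.
[cite: MochizukiSemiAnbd2006, §6 p.77] -/
theorem image_map_hatOf_eq_of_liesUnder (αhat : X.PiHat ≃ₜ* Y.PiHat) (β : X.PiTemp ≃ₜ* Y.PiTemp)
    (c : Y.PiHat) (h : ∀ g : X.PiTemp, αhat (X.toHat g) = c * Y.toHat (β g) * c⁻¹)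
    (𝒮 : Set (Subgroup X.PiTemp)) :
    (fun S => S.map αhat.toMulEquiv.toMonoidHom) '' X.hatOf 𝒮 =
      (fun S => ConjAct.toConjAct c • S) '' Y.hatOf ((fun S => S.map β.toMulEquiv.toMonoidHom) '' 𝒮) := by
  rw [hatOf, hatOf, Set.image_image, Set.image_image, Set.image_image]
  exact Set.image_congr' fun S => map_closure_map_toHat_eq_of_liesUnder αhat β c h S

/-- Transport of `D̂_x` along a lifting pair: if `β(D_x) = γ D_y γ⁻¹` and `β` lies under `α̂` through
`c`, then `α̂(D̂_x) = (c ι_Y(γ)) D̂_y (c ι_Y(γ))⁻¹`. [cite: MochizukiSemiAnbd2006, §6 p.77] -/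
theorem map_decompHat_eq_of_liesUnder (αhat : X.PiHat ≃ₜ* Y.PiHat) (β : X.PiTemp ≃ₜ* Y.PiTemp)
    (c : Y.PiHat) (h : ∀ g : X.PiTemp, αhat (X.toHat g) = c * Y.toHat (β g) * c⁻¹) (x : X.Pt) (y : Y.Pt)
    (γ : ConjAct Y.PiTemp) (hD : (X.decomp x).map β.toMulEquiv.toMonoidHom = γ • Y.decomp y) :
    (X.decompHat x).map αhat.toMulEquiv.toMonoidHom =
      ConjAct.toConjAct (c * Y.toHat (ConjAct.ofConjAct γ)) • Y.decompHat y := by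
  rw [decompHat, decompHat, map_closure_map_toHat_eq_of_liesUnder αhat β c h, hD, map_conjAct_smul_ofConjAct,
    ← conjAct_smul_topologicalClosure, smul_smul, ← map_mul]
  rfl

/-- A COMPACT subgroup of `Π^temp` is recovered from the closure of its image in the (Hausdorff)
profinite completion along the injection `ι : Π^temp ↪ Π̂` (the image is compact, hence closed).
[cite: MochizukiSemiAnbd2006, §6 p.69] -/
theorem comap_closure_map_toHat_eq_of_isCompact (S : Subgroup Y.PiTemp) (hS : IsCompact (S : Set Y.PiTemp)) :
    ((S.map Y.toHat.toMonoidHom).topologicalClosure).comap Y.toHat.toMonoidHom = S := by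
  haveI : T2Space Y.PiHat := Y.isProfiniteCompletion_toHat.t2Space
  have hcl : (S.map Y.toHat.toMonoidHom).topologicalClosure = S.map Y.toHat.toMonoidHom := by
    apply SetLike.coe_injective
    rw [Subgroup.topologicalClosure_coe, Subgroup.coe_map]
    exact (hS.image Y.toHat.continuous).isClosed.closure_eq
  rw [hcl]
  exact Subgroup.comap_map_eq_self_of_injective Y.toHat_injective S

/-- Under the COMPACTNESS LAW the closure map `S ↦ closure ι_Y(S)` is injective: two sets of compact
subgroups of `Π^temp_{Y_L}` with the same image under `hatOf` are equal.
[cite: MochizukiSemiAnbd2006, §6 p.77] -/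
theorem eq_of_hatOf_eq_of_isCompact {A B : Set (Subgroup Y.PiTemp)}
    (hA : ∀ S ∈ A, IsCompact (S : Set Y.PiTemp)) (hB : ∀ S ∈ B, IsCompact (S : Set Y.PiTemp))
    (h : Y.hatOf A = Y.hatOf B) : A = B := by
  have hinj : Set.InjOn (fun S : Subgroup Y.PiTemp => (S.map Y.toHat.toMonoidHom).topologicalClosure)
      (A ∪ B) := by
    intro S hS S' hS' hSS'
    have hc : ∀ T ∈ A ∪ B, IsCompact (T : Set Y.PiTemp) := fun T hT => hT.elim (hA T) (hB T)
    rw [← comap_closure_map_toHat_eq_of_isCompact S (hc S hS),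
      ← comap_closure_map_toHat_eq_of_isCompact S' (hc S' hS')]
    exact congrArg (fun K : Subgroup Y.PiHat => K.comap Y.toHat.toMonoidHom) hSS'
  exact (hinj.image_eq_image_iff Set.subset_union_left Set.subset_union_right).mp h

/-- Images of compact subgroups of `Π^temp_{X_K}` under a tempered isomorphism are compact.
[cite: MochizukiSemiAnbd2006, §6 p.77] -/
theorem isCompact_coe_map_equiv (β : X.PiTemp ≃ₜ* Y.PiTemp) (S : Subgroup X.PiTemp)
    (hS : IsCompact (S : Set X.PiTemp)) :
    IsCompact ((S.map β.toMulEquiv.toMonoidHom : Subgroup Y.PiTemp) : Set Y.PiTemp) := by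
  rw [Subgroup.coe_map]
  exact hS.image β.continuous

/-- Conjugates of compact subgroups of `Π^temp_{Y_L}` are compact. [cite: MochizukiSemiAnbd2006, §6 p.77] -/
theorem isCompact_coe_conjAct_smul (γ : ConjAct Y.PiTemp) (S : Subgroup Y.PiTemp)
    (hS : IsCompact (S : Set Y.PiTemp)) : IsCompact ((γ • S : Subgroup Y.PiTemp) : Set Y.PiTemp) := by
  have hγ : γ = ConjAct.toConjAct (ConjAct.ofConjAct γ) := (ConjAct.toConjAct_ofConjAct γ).symm
  rw [hγ, coe_conjAct_smul_eq_image]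
  exact hS.image (by fun_prop)

end TemperedCurve

/-! ### 2. Cor. 6.10 (ii) from Thm. 6.6 and the goodness / transport law -/

namespace AbsolutenessOrigin

variable (Ω : AbsolutenessOrigin p)

/-- **Cor. 6.10 (ii), direction "unitwise absolute ⇒ unitwise temp-absolute"**, for the genuine pairs
over `X_K`: every tempered isomorphism `β` completes to a profinite `β̂` (tree:
`TemperedCurve.temperedIsoCompletes_holds`), and by the goodness / transport law (hypothesis `hgood`:
for `β` lying under `α̂` the two induced maps carry the Kummer image of the units to the same subgroup)
the profinite statement for `β̂` is the tempered statement for `β`.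
[cite: MochizukiSemiAnbd2006, Cor 6.10(ii) p.77] -/
theorem isUnitwiseTempAbsolute_of_isUnitwiseAbsolute {X : TemperedCurve p} (kX : KummerUnitData X)
    (hgood : ∀ (Y : TemperedCurve p) (kY : KummerUnitData Y) (t : KummerTransport kX kY),
      Ω.IsHyperbolicCurveOrigin Y → Ω.IsKummerOrigin kY → Ω.IsKummerTransportOrigin t →
      ∀ (αhat : X.PiHat ≃ₜ* Y.PiHat) (β : X.PiTemp ≃ₜ* Y.PiTemp), TemperedCurve.LiesUnder X Y αhat β →
        (kX.unitImage).map (t.h1OfHat αhat).toAddMonoidHom =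
          (kX.unitImage).map (t.h1OfTemp β).toAddMonoidHom)
    (h : Ω.IsUnitwiseAbsolute kX) : Ω.IsUnitwiseTempAbsolute kX := by
  intro Y kY t hY hkY ht β
  obtain ⟨αhat, hα⟩ := TemperedCurve.temperedIsoCompletes_holds X Y β
  have hunder : TemperedCurve.LiesUnder X Y αhat β := ⟨1, fun g => by simpa using hα g⟩
  rw [← hgood Y kY t hY hkY ht αhat β hunder]
  exact h Y kY t hY hkY ht αhat

/-- **Cor. 6.10 (ii), direction "unitwise temp-absolute ⇒ unitwise absolute"**: every profinite
isomorphism `α̂` has a tempered `β` lying under it (Thm. 6.6 `TemperedCurve.ProfiniteOuterIsoLifts`,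
hypothesis `h66` for the genuine `Y`), and the goodness / transport law identifies the two statements.
[cite: MochizukiSemiAnbd2006, Cor 6.10(ii) p.77] -/
theorem isUnitwiseAbsolute_of_isUnitwiseTempAbsolute {X : TemperedCurve p} (kX : KummerUnitData X)
    (h66 : ∀ Y : TemperedCurve p, Ω.IsHyperbolicCurveOrigin Y → X.ProfiniteOuterIsoLifts Y)
    (hgood : ∀ (Y : TemperedCurve p) (kY : KummerUnitData Y) (t : KummerTransport kX kY),
      Ω.IsHyperbolicCurveOrigin Y → Ω.IsKummerOrigin kY → Ω.IsKummerTransportOrigin t →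
      ∀ (αhat : X.PiHat ≃ₜ* Y.PiHat) (β : X.PiTemp ≃ₜ* Y.PiTemp), TemperedCurve.LiesUnder X Y αhat β →
        (kX.unitImage).map (t.h1OfHat αhat).toAddMonoidHom =
          (kX.unitImage).map (t.h1OfTemp β).toAddMonoidHom)
    (h : Ω.IsUnitwiseTempAbsolute kX) : Ω.IsUnitwiseAbsolute kX := by
  intro Y kY t hY hkY ht αhat
  obtain ⟨⟨β, hβ⟩, -⟩ := h66 Y hY αhat
  rw [hgood Y kY t hY hkY ht αhat β hβ]
  exact h Y kY t hY hkY ht β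

/-- **[SemiAnbd] Cor. 6.10 (ii)** ("`X_K` is unitwise absolute iff unitwise temp-absolute") over the
typed interface, FROM Thm. 6.6 for the genuine pairs over `X_K` and the goodness / transport law — the
printed inference "`Π^temp_{X_K}` is also good. We thus conclude [cf. Theorem 6.6]" (p. 77).
[cite: MochizukiSemiAnbd2006, Cor 6.10(ii) p.77] -/
theorem unitwiseAbsoluteIffTempAbsolute_of_profiniteOuterIsoLifts {X : TemperedCurve p}
    (kX : KummerUnitData X)
    (h66 : ∀ Y : TemperedCurve p, Ω.IsHyperbolicCurveOrigin Y → X.ProfiniteOuterIsoLifts Y)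
    (hgood : ∀ (Y : TemperedCurve p) (kY : KummerUnitData Y) (t : KummerTransport kX kY),
      Ω.IsHyperbolicCurveOrigin Y → Ω.IsKummerOrigin kY → Ω.IsKummerTransportOrigin t →
      ∀ (αhat : X.PiHat ≃ₜ* Y.PiHat) (β : X.PiTemp ≃ₜ* Y.PiTemp), TemperedCurve.LiesUnder X Y αhat β →
        (kX.unitImage).map (t.h1OfHat αhat).toAddMonoidHom =
          (kX.unitImage).map (t.h1OfTemp β).toAddMonoidHom) :
    Ω.UnitwiseAbsoluteIffTempAbsolute kX :=
  ⟨Ω.isUnitwiseTempAbsolute_of_isUnitwiseAbsolute kX hgood,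
    Ω.isUnitwiseAbsolute_of_isUnitwiseTempAbsolute kX h66 hgood⟩

/-- The same with Thm. 6.6 consumed BY NAME as the FACT-LIST row F-1707
`TemperedOrigin.ProfiniteOuterIsoLiftsHolds` (for a genuine `X_K`). [cite: MochizukiSemiAnbd2006, Cor 6.10(ii) p.77] -/
theorem unitwiseAbsoluteIffTempAbsolute_of_profiniteOuterIsoLiftsHolds
    (h66 : Ω.toTemperedOrigin.ProfiniteOuterIsoLiftsHolds) {X : TemperedCurve p}
    (hX : Ω.IsHyperbolicCurveOrigin X) (kX : KummerUnitData X)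
    (hgood : ∀ (Y : TemperedCurve p) (kY : KummerUnitData Y) (t : KummerTransport kX kY),
      Ω.IsHyperbolicCurveOrigin Y → Ω.IsKummerOrigin kY → Ω.IsKummerTransportOrigin t →
      ∀ (αhat : X.PiHat ≃ₜ* Y.PiHat) (β : X.PiTemp ≃ₜ* Y.PiTemp), TemperedCurve.LiesUnder X Y αhat β →
        (kX.unitImage).map (t.h1OfHat αhat).toAddMonoidHom =
          (kX.unitImage).map (t.h1OfTemp β).toAddMonoidHom) :
    Ω.UnitwiseAbsoluteIffTempAbsolute kX :=
  Ω.unitwiseAbsoluteIffTempAbsolute_of_profiniteOuterIsoLifts kX (fun Y hY => h66 X Y hX hY) hgood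

/-! ### 3. Cor. 6.10 (i), direction "absolute ⇒ temp-absolute", under the compactness law -/

/-- **Cor. 6.10 (i), discrete clause, direction "discretely absolute ⇒ discretely temp-absolute"** over
the typed interface: given `β : Π^temp_{X_K} ⥲ Π^temp_{Y_L}` with `β(D_x) = γ D_y γ⁻¹`, its completion
`β̂` (tree) satisfies `β̂(D̂_x) = ι(γ) D̂_y ι(γ)⁻¹` (`map_decompHat_eq_of_completes`); the profinite
compatibility for `β̂` reads `hatOf_Y(β 𝒮_X) = hatOf_Y(γ 𝒮_Y γ⁻¹)`, and `S ↦ closure ι_Y(S)` is injective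
on these subgroups under the COMPACTNESS LAW (hypotheses `hcX`, `hcY`: members of the canonical discrete
structures are compact — [Mzk8] §4 p. 33, images of sections of `D ↠ G_K`).
[cite: MochizukiSemiAnbd2006, Cor 6.10(i) p.77] -/
theorem isDiscretelyTempAbsoluteCusp_of_isDiscretelyAbsoluteCusp {X : TemperedCurve p}
    (SX : CuspidalStructures X) (x : X.Pt)
    (hcX : ∀ S ∈ SX.canonicalDiscrete x, IsCompact (S : Set X.PiTemp))
    (hcY : ∀ (Y : TemperedCurve p) (SY : CuspidalStructures Y), Ω.IsHyperbolicCurveOrigin Y →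
      Ω.IsStructuresOrigin SY → ∀ (y : Y.Pt), Y.IsCusp y →
        ∀ S ∈ SY.canonicalDiscrete y, IsCompact (S : Set Y.PiTemp))
    (h : Ω.IsDiscretelyAbsoluteCusp SX x) : Ω.IsDiscretelyTempAbsoluteCusp SX x := by
  intro Y SY hY hSY β y γ hy hD
  obtain ⟨αhat, hα⟩ := TemperedCurve.temperedIsoCompletes_holds X Y β
  have hEq := h Y SY hY hSY αhat y _ hy (TemperedCurve.map_decompHat_eq_of_completes αhat β hα x y γ hD)
  rw [TemperedCurve.image_map_hatOf_eq_of_completes αhat β hα, TemperedCurve.image_conj_hatOf_eq] at hEq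
  refine TemperedCurve.eq_of_hatOf_eq_of_isCompact ?_ ?_ hEq
  · rintro _ ⟨S₁, hS₁, rfl⟩
    exact TemperedCurve.isCompact_coe_map_equiv β S₁ (hcX S₁ hS₁)
  · rintro _ ⟨S₀, hS₀, rfl⟩
    exact TemperedCurve.isCompact_coe_conjAct_smul γ S₀ (hcY Y SY hY hSY y hy S₀ hS₀)

/-- **Cor. 6.10 (i), integral clause, direction "integrally absolute ⇒ integrally temp-absolute"**, under
the same compactness law for the canonical DISCRETE structures (an integral structure refines the
discrete one, `CuspidalStructures.canonicalIntegral_subset`). [cite: MochizukiSemiAnbd2006, Cor 6.10(i) p.77] -/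
theorem isIntegrallyTempAbsoluteCusp_of_isIntegrallyAbsoluteCusp {X : TemperedCurve p}
    (SX : CuspidalStructures X) (x : X.Pt)
    (hcX : ∀ S ∈ SX.canonicalDiscrete x, IsCompact (S : Set X.PiTemp))
    (hcY : ∀ (Y : TemperedCurve p) (SY : CuspidalStructures Y), Ω.IsHyperbolicCurveOrigin Y →
      Ω.IsStructuresOrigin SY → ∀ (y : Y.Pt), Y.IsCusp y →
        ∀ S ∈ SY.canonicalDiscrete y, IsCompact (S : Set Y.PiTemp))
    (h : Ω.IsIntegrallyAbsoluteCusp SX x) : Ω.IsIntegrallyTempAbsoluteCusp SX x := by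
  intro Y SY hY hSY β y γ hy hD
  obtain ⟨αhat, hα⟩ := TemperedCurve.temperedIsoCompletes_holds X Y β
  have hEq := h Y SY hY hSY αhat y _ hy (TemperedCurve.map_decompHat_eq_of_completes αhat β hα x y γ hD)
  rw [TemperedCurve.image_map_hatOf_eq_of_completes αhat β hα, TemperedCurve.image_conj_hatOf_eq] at hEq
  refine TemperedCurve.eq_of_hatOf_eq_of_isCompact ?_ ?_ hEq
  · rintro _ ⟨S₁, hS₁, rfl⟩
    exact TemperedCurve.isCompact_coe_map_equiv β S₁ (hcX S₁ (SX.canonicalIntegral_subset x hS₁))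
  · rintro _ ⟨S₀, hS₀, rfl⟩
    exact TemperedCurve.isCompact_coe_conjAct_smul γ S₀
      (hcY Y SY hY hSY y hy S₀ (SY.canonicalIntegral_subset y hS₀))

/-! ### 4. Cor. 6.11 from Cor. 6.10 and [Mzk8] Cor. 4.11 (the printed proof, p. 78 l. 1–2) -/

/-- **[SemiAnbd] Cor. 6.11 from Cor. 6.10**, the printed proof (p. 78 l. 1–2): "this follows by formally
'substituting' the equivalences of Corollary 6.10, (i), (ii), into [Mzk8], Corollary 4.11."  Over the
typed interface: F-1655 `GenusZeroTempAbsolutenessHolds Ω` follows from F-1656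
`TemperedAbsolutenessHolds Ω` and the [Mzk8] Cor. 4.11 input in its ABSOLUTE form (hypothesis `hCor411`:
a genuine hyperbolic curve with stable reduction over `O_K`, isogenous to a hyperbolic curve of genus
zero, is unitwise absolute and each of its `K`-rational cusps is integrally absolute — not typed in the
tree, hence a binder here, never asserted). [cite: MochizukiSemiAnbd2006, Cor 6.11 pp.77-78] -/
theorem genusZeroTempAbsolutenessHolds_of_temperedAbsolutenessHolds
    (h610 : Ω.TemperedAbsolutenessHolds)
    (hCor411 : ∀ (X : TemperedCurve p) (SX : CuspidalStructures X) (kX : KummerUnitData X)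
      (aX : TemperedCurve.CurveArithmeticFlags X), Ω.IsHyperbolicCurveOrigin X →
      Ω.IsStructuresOrigin SX → Ω.IsKummerOrigin kX → Ω.IsFlagsOrigin aX →
      SX.HasStableReduction → aX.IsIsogenousToGenusZero →
        Ω.IsUnitwiseAbsolute kX ∧
          ∀ x : X.Pt, X.IsCusp x → X.IsRationalPt x → Ω.IsIntegrallyAbsoluteCusp SX x) :
    Ω.GenusZeroTempAbsolutenessHolds := by
  intro X SX kX aX hX hSX hkX haX hst hg0
  obtain ⟨hunit, hcusp⟩ := hCor411 X SX kX aX hX hSX hkX haX hst hg0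
  obtain ⟨hi, hii⟩ := h610 X SX kX hX hSX hkX
  exact ⟨hii.mp hunit, fun x hx hr => ((hi x hx hr).2 hst).mp (hcusp x hx hr)⟩

/-- **Cor. 6.11 at one curve**, same reduction stated per datum: the conclusion
`GenusZeroTempAbsoluteness SX kX aX` of F-1655 for a genuine `(X, SX, kX)` from Cor. 6.10 at that datum
(`AbsoluteIffTempAbsoluteCusp SX ∧ UnitwiseAbsoluteIffTempAbsolute kX`) and the absolute [Mzk8] Cor. 4.11
conclusions for it. [cite: MochizukiSemiAnbd2006, Cor 6.11 pp.77-78] -/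
theorem genusZeroTempAbsoluteness_of_absoluteIff {X : TemperedCurve p} (SX : CuspidalStructures X)
    (kX : KummerUnitData X) (aX : TemperedCurve.CurveArithmeticFlags X)
    (h610 : Ω.AbsoluteIffTempAbsoluteCusp SX ∧ Ω.UnitwiseAbsoluteIffTempAbsolute kX)
    (hCor411 : SX.HasStableReduction → aX.IsIsogenousToGenusZero →
      Ω.IsUnitwiseAbsolute kX ∧
        ∀ x : X.Pt, X.IsCusp x → X.IsRationalPt x → Ω.IsIntegrallyAbsoluteCusp SX x) :
    Ω.GenusZeroTempAbsoluteness SX kX aX := by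
  intro hst hg0
  obtain ⟨hunit, hcusp⟩ := hCor411 hst hg0
  exact ⟨h610.2.mp hunit, fun x hx hr => ((h610.1 x hx hr).2 hst).mp (hcusp x hx hr)⟩

end AbsolutenessOrigin

end Literature.AnabelianGeometry.SemiGraphs

end
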